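import Literature.Analysis.DeBrangesSpaces.BurnolSonineLemma3Proofs
import Literature.NumberTheory.LFunctions.ProlateBandSincOperator
import Literature.NumberTheory.LFunctions.ProlateBandCommutation
import HarnessLib

/-!
# Burnol 2002 (CRAS 335), Lemme 3 — DISCHARGED at every cutoff `λ > 0`: the completeness input `(h_C)`
# at a general band, transported to `L²(ℝ)`, and `Burnol2002CRAS_lem3_holds`

LABEL (line 1): **RH-FREE** — Fourier analysis of the cutoff projections `P_λ`, `P̃_λ` on `L²(ℝ)` and of the
prolate spheroidal functions of band `[−λ,λ]` (Slepian–Pollak completeness at a general band); `ζ` does not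
occur. bears_on: LADDER-RH COLUMN 6 (DBR), B-C, as corpus vocabulary only. WHAT THIS IS NOT: not a route,
not a criterion; an `L²` eigenbasis statement and an eigenvector computation for `P_λ + P̃_λ`; nothing here
bears on the truth of RH.

This file closes the named fact `Literature.Analysis.DeBrangesSpaces.Burnol2002.Burnol2002CRAS_lem3`
(J.-F. Burnol, C. R. Math. Acad. Sci. Paris **335** (2002) 689–692 = arXiv:math/0208121, Lemme 3, TeX
l.289–293) through the ONE-input door `Burnol2002CRAS_lem3_of_complete` of
`BurnolSonineLemma3Proofs.lean` (whose input (h_I) is a theorem at every band there): the input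
`(h_C)` — completeness of the even prolate classes of band `[−λ,λ]` in `P_λ(L²(ℝ))^{pair}` at EVERY
`λ > 0` — is supplied here (`complete_band`) from the general-band Slepian–Pollak modules
`Literature/NumberTheory/LFunctions/ProlateBandSincOperator.lean` (the sinc operator
`K_λ = 𝒫_λ𝒫̂_λ𝒫_λ` on `L²([−λ,λ])`: compact, self-adjoint, `ker K_λ = 0`, assembly modulo the
commutation step) and `…/ProlateBandCommutation.lean` (`[𝐖_λ, K_λ] = 0`: every even eigenvector of
`K_λ` is a combination of prolate functions of band `λ`), exactly as the tree's band-1 chain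
`ConnesConsani2021/ProlateSincOperator → ProlateCommutation → ProlateProjectionsCompleteness` supplies it
at `λ = 1` (`Burnol2002.complete_one`).

* `eq_zero_of_even_of_cutoffProj_eq_of_orthogonal` — the transport `L²(ℝ) ⊇ range P_λ ≅ L²([−λ,λ])`:
  an a.e.-even `ξ ∈ L²(ℝ)` with `P_λ ξ = ξ` orthogonal to every `L²(ℝ)` class of an even-indexed prolate
  function `h_{2n,λ}` vanishes (port of `ConnesConsani2021.CC2021_sec4_xi_complete_of_commutation`);
* `complete_band` — `(h_C)` at every `λ > 0` in the exact shape of the door (port of `complete_one`);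
* `Burnol2002CRAS_lem3_holds : Burnol2002CRAS_lem3`.

No definition, no new named fact (D-0026): theorems only.

## References
* [Burnol2002CRAS] J.-F. Burnol, C. R. Math. Acad. Sci. Paris 335 (2002) 689–692 = arXiv:math/0208121,
  Lemme 3 (TeX l.289–293).
* [SlepianPollak1961] D. Slepian, H. O. Pollak, Bell System Tech. J. 40 (1961) 43–63, §III (completeness of
  the prolate spheroidal wave functions, general time–bandwidth parameter).
* [ConnesConsani2021] A. Connes, C. Consani, arXiv:2006.13771, §4 pp. 16–17 (the band-1 road followed).
-/

noncomputable section

open _root_.MeasureTheory _root_.Complex _root_.Set _root_.Filter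
open scoped Real Topology FourierTransform InnerProductSpace ComplexConjugate
open Literature.NumberTheory.LFunctions (evenL2 IsProlateFunction)
open Literature.NumberTheory.LFunctions.ProlateBand (measurePreserving_neg_Icc
  eq_zero_of_even_of_orthogonal_prolateBand even_eigenvector_mem_span_prolateBand)
open Literature.NumberTheory.ConnesConsani2021 (cutoffProj cutoffProj_coeFn isStarProjection_cutoffProj
  evenPart mem_evenPart_iff isClosed_evenPart)

namespace Literature.Analysis.DeBrangesSpaces

namespace Burnol2002

section Band

variable {lam : ℝ}

/-- **Transport `L²(ℝ) ⊇ range P_λ ≅ L²([−λ,λ])` of the band-`λ` completeness**: an a.e.-even `ξ ∈ L²(ℝ)`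
with `P_λ ξ = ξ` which is orthogonal to every `L²(ℝ)` class of an even-indexed prolate function `h_{2n,λ}`
(`IsProlateFunction λ (2n)`) vanishes — restrict `ξ` to `[−λ,λ]`, apply
`ProlateBand.eq_zero_of_even_of_orthogonal_prolateBand` (Hilbert eigenbasis of the compact self-adjoint sinc
operator, `ker = 0`) with the commutation step `ProlateBand.even_eigenvector_mem_span_prolateBand`, and use
`ξ = 1_{[−λ,λ]}ξ`. [cite: SlepianPollak1961, §III; ConnesConsani2021, Prop. 4.5 (i)–(ii) §4 p. 16 (arXiv p0016:L48–L66)] -/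
theorem eq_zero_of_even_of_cutoffProj_eq_of_orthogonal (hlam : 0 < lam)
    {ξ : Lp ℂ 2 (volume : Measure ℝ)} (hev : ∀ᵐ x : ℝ, (ξ : ℝ → ℂ) (-x) = (ξ : ℝ → ℂ) x)
    (hP : cutoffProj lam ξ = ξ)
    (horth : ∀ (n : ℕ) (e : ℝ → ℝ) (E : Lp ℂ 2 (volume : Measure ℝ)), IsProlateFunction lam (2 * n) e →
      (∀ᵐ x : ℝ, E x = (e x : ℂ)) → ⟪E, ξ⟫_ℂ = 0) :
    ξ = 0 := by
  set f : Lp ℂ 2 (volume.restrict (Icc (-lam) lam)) :=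
    ((Lp.memLp ξ).restrict (Icc (-lam) lam)).toLp (ξ : ℝ → ℂ) with hfdef
  have hf : (f : ℝ → ℂ) =ᵐ[volume.restrict (Icc (-lam) lam)] (ξ : ℝ → ℂ) := MemLp.coeFn_toLp _
  -- `f` is even a.e. on `[-λ, λ]`
  have heven : ∀ᵐ x ∂(volume.restrict (Icc (-lam) lam)), (f : ℝ → ℂ) (-x) = (f : ℝ → ℂ) x := by
    have h1 : (fun x => (f : ℝ → ℂ) (-x)) =ᵐ[volume.restrict (Icc (-lam) lam)]
        fun x => (ξ : ℝ → ℂ) (-x) :=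
      (measurePreserving_neg_Icc lam).quasiMeasurePreserving.ae_eq_comp hf
    filter_upwards [hf, h1, ae_restrict_of_ae (s := Icc (-lam) lam) hev] with x hx hx' hx''
    rw [hx', hx'', hx]
  -- `f` is orthogonal to the prolate classes of band `λ`
  have horth' : ∀ T ∈ {T : Lp ℂ 2 (volume.restrict (Icc (-lam) lam)) | ∃ (n : ℕ) (e : ℝ → ℝ),
      IsProlateFunction lam (2 * n) e ∧
        (T : ℝ → ℂ) =ᵐ[volume.restrict (Icc (-lam) lam)] fun x => (e x : ℂ)}, ⟪T, f⟫_ℂ = 0 := by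
    rintro T ⟨n, e, he, hT⟩
    set E : Lp ℂ 2 (volume : Measure ℝ) := (prolate_memLp_ofReal he).toLp _ with hEdef
    have hE : ∀ᵐ x : ℝ, (E : ℝ → ℂ) x = (e x : ℂ) := (prolate_memLp_ofReal he).coeFn_toLp
    have h0 := horth n e E he hE
    rw [L2.inner_def] at h0 ⊢
    have h1 : ∫ x, ⟪(T : ℝ → ℂ) x, (f : ℝ → ℂ) x⟫_ℂ ∂(volume.restrict (Icc (-lam) lam)) =
        ∫ x in Icc (-lam) lam, conj (e x : ℂ) * (ξ : ℝ → ℂ) x := by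
      refine integral_congr_ae ?_
      filter_upwards [hT, hf] with x hx hx'
      rw [hx, hx', RCLike.inner_apply']
    have h2 : ∫ x, ⟪(E : ℝ → ℂ) x, (ξ : ℝ → ℂ) x⟫_ℂ =
        ∫ x, (Icc (-lam) lam).indicator (fun x => conj (e x : ℂ) * (ξ : ℝ → ℂ) x) x := by
      refine integral_congr_ae ?_
      filter_upwards [hE] with x hx
      rw [hx, RCLike.inner_apply']
      by_cases hxI : x ∈ Icc (-lam) lam
      · rw [indicator_of_mem hxI]
      · rw [indicator_of_notMem hxI, prolate_eq_zero_of_notMem_Icc he hxI, Complex.ofReal_zero, map_zero,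
          zero_mul]
    rw [h1]
    rw [h2, integral_indicator measurableSet_Icc] at h0
    exact h0
  -- the assembly on `L²([−λ,λ])`, with the commutation step as `hstep3`
  have hf0 : f = 0 := by
    refine eq_zero_of_even_of_orthogonal_prolateBand hlam ?_ heven horth'
    intro K hK hKc _hKsa ν hν S hS hSev
    exact even_eigenvector_mem_span_prolateBand hlam K hK hKc hν hS hSev
  -- hence `ξ = 0` a.e. on `[-λ,λ]`, and `ξ = 1_{[-λ,λ]} ξ` a.e.
  have h1 : ∀ᵐ x ∂(volume.restrict (Icc (-lam) lam)), (ξ : ℝ → ℂ) x = 0 := by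
    have h0 := Lp.coeFn_zero ℂ 2 (volume.restrict (Icc (-lam) lam))
    rw [← hf0] at h0
    filter_upwards [hf, h0] with x hx hx'
    rw [← hx, hx', Pi.zero_apply]
  have h2 : ∀ᵐ x : ℝ, x ∈ Icc (-lam) lam → (ξ : ℝ → ℂ) x = 0 := (ae_restrict_iff' measurableSet_Icc).1 h1
  have h3 : (ξ : ℝ → ℂ) =ᵐ[volume] (Icc (-lam) lam).indicator (ξ : ℝ → ℂ) := by
    have h := cutoffProj_coeFn lam ξ
    rw [hP] at h
    exact h
  refine Lp.ext ?_
  filter_upwards [h2, h3, Lp.coeFn_zero ℂ 2 (volume : Measure ℝ)] with x hx hx' h0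
  rw [h0, Pi.zero_apply]
  by_cases hxI : x ∈ Icc (-lam) lam
  · exact hx hxI
  · rw [hx', indicator_of_notMem hxI]

/-- **(h_C) at every band `λ > 0`**: the even prolate classes of band `[−λ, λ]` are complete in
`P_λ(L²(ℝ))^{pair}` — for every a.e.-even `u ∈ L²(ℝ)`, `P_λ u` lies in the closed span of the `L²(ℝ)`
classes of the even-indexed prolate functions `h_{2n,λ}` (Slepian–Pollak 1961 §III: "the ψ_n are complete
in L²(−T/2,T/2)"): the component of `P_λu` orthogonal to the closed span is even, time-limited and
orthogonal to every prolate class, hence zero (`eq_zero_of_even_of_cutoffProj_eq_of_orthogonal`).  The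
`λ = 1` instance is `complete_one`. [cite: SlepianPollak1961, §III; Burnol2002CRAS, Lemme 3 (TeX l.289–293)] -/
theorem complete_band (lam : ℝ) (hlam : 0 < lam) : ∀ u ∈ evenL2, cutoffProj lam u ∈
    closure (Submodule.span ℂ {E : Lp ℂ 2 (volume : Measure ℝ) | ∃ (n : ℕ) (e : ℝ → ℝ),
      IsProlateFunction lam (2 * n) e ∧ ∀ᵐ x : ℝ, E x = (e x : ℂ)} : Set (Lp ℂ 2 (volume : Measure ℝ))) := by
  intro u hu
  set Spr : Set (Lp ℂ 2 (volume : Measure ℝ)) := {E | ∃ (n : ℕ) (e : ℝ → ℝ),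
    IsProlateFunction lam (2 * n) e ∧ ∀ᵐ x : ℝ, E x = (e x : ℂ)} with hSpr
  set K : Submodule ℂ (Lp ℂ 2 (volume : Measure ℝ)) := Submodule.span ℂ Spr with hK
  set W : Submodule ℂ (Lp ℂ 2 (volume : Measure ℝ)) := K.topologicalClosure with hW
  haveI : CompleteSpace W := K.isClosed_topologicalClosure.completeSpace_coe
  have hP := isStarProjection_cutoffProj lam
  have hPP : ∀ z, cutoffProj lam (cutoffProj lam z) = cutoffProj lam z := fun z ↦ by
    have := congrArg (fun T : Lp ℂ 2 (volume : Measure ℝ) →L[ℂ] Lp ℂ 2 (volume : Measure ℝ) => T z)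
      hP.isIdempotentElem.eq
    simpa [mul_apply_eq_comp] using this
  -- `W` consists of even, time-limited classes
  have hKev : K ≤ evenPart := Submodule.span_le.mpr (by rintro E ⟨n, e, he, hE⟩; exact mem_evenL2 he hE)
  have hWev : W ≤ evenPart := K.topologicalClosure_minimal hKev isClosed_evenPart
  set Fix : Submodule ℂ (Lp ℂ 2 (volume : Measure ℝ)) :=
    LinearMap.eqLocus ((cutoffProj lam : Lp ℂ 2 (volume : Measure ℝ) →L[ℂ] Lp ℂ 2 (volume : Measure ℝ)) :
      Lp ℂ 2 (volume : Measure ℝ) →ₗ[ℂ] Lp ℂ 2 (volume : Measure ℝ)) LinearMap.id with hFix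
  have hFixc : IsClosed (Fix : Set (Lp ℂ 2 (volume : Measure ℝ))) :=
    isClosed_eq (cutoffProj lam).continuous continuous_id
  have hKFix : K ≤ Fix := Submodule.span_le.mpr (by
    rintro E ⟨n, e, he, hE⟩
    exact (LinearMap.mem_eqLocus).mpr (cutoffProj_eq_self he hE))
  have hWFix : W ≤ Fix := K.topologicalClosure_minimal hKFix hFixc
  -- the component of `P u` orthogonal to `W`
  set x : Lp ℂ 2 (volume : Measure ℝ) := cutoffProj lam u with hx
  set q : Lp ℂ 2 (volume : Measure ℝ) := x - W.starProjection x with hq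
  have hqo : q ∈ Wᗮ := Submodule.sub_starProjection_mem_orthogonal x
  have hpW : W.starProjection x ∈ W := Submodule.starProjection_apply_mem W x
  have hqev : q ∈ evenPart := evenPart.sub_mem (cutoffProj_mem_evenL2_of_mem_evenL2 lam hu) (hWev hpW)
  have hPp : cutoffProj lam (W.starProjection x) = W.starProjection x :=
    (LinearMap.mem_eqLocus).mp (hWFix hpW)
  have hPq : cutoffProj lam q = q := by rw [hq, map_sub, hx, hPP, ← hx, hPp]
  have horth : ∀ (n : ℕ) (e : ℝ → ℝ) (E : Lp ℂ 2 (volume : Measure ℝ)), IsProlateFunction lam (2 * n) e →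
      (∀ᵐ y : ℝ, E y = (e y : ℂ)) → ⟪E, q⟫_ℂ = 0 := fun n e E he hE ↦ by
    have hmem : E ∈ W := K.le_topologicalClosure (Submodule.subset_span ⟨n, e, he, hE⟩)
    exact Submodule.inner_right_of_mem_orthogonal hmem hqo
  have hq0 : q = 0 :=
    eq_zero_of_even_of_cutoffProj_eq_of_orthogonal hlam (mem_evenPart_iff.1 hqev) hPq horth
  have hxp : x = W.starProjection x := by rw [hq] at hq0; exact sub_eq_zero.mp hq0
  rw [hxp, ← Submodule.topologicalClosure_coe]
  exact hpW

end Band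

/-- **Burnol 2002 (CRAS 335), Lemme 3 — PROVED at every cutoff `λ > 0`** (discharge of the named fact
`Burnol2002CRAS_lem3`, verbatim TeX l.289–293: *Les vecteurs propres de l'opérateur (dans `G_λ`) de
Fredholm `P_λ + P̃_λ` sont les vecteurs `e_{2n} ± 𝓕₊(e_{2n})`, `n ∈ ℕ`. Ils forment une base orthogonale de
`G_λ` puisque l'opérateur est auto-adjoint*): the door `Burnol2002CRAS_lem3_of_complete` (clauses (i),
(iii)-orthogonality unconditional, (ii) + (iii)-density from Slepian–Pollak completeness, the spectral
simplicity (h_I) a theorem at every band) fed with `complete_band`, the completeness of the even prolate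
classes of band `[−λ,λ]` in `P_λ(L²(ℝ))^{pair}` (general-band port of Connes–Consani 2021 §4 /
Slepian–Pollak 1961 §III). [cite: Burnol2002CRAS, Lemme 3 (TeX l.289–293); SlepianPollak1961, §III] -/
theorem Burnol2002CRAS_lem3_holds : Burnol2002CRAS_lem3 :=
  Burnol2002CRAS_lem3_of_complete complete_band

end Burnol2002

end Literature.Analysis.DeBrangesSpaces
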